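import Summits.Ventures.LatticeQCDFlow.Scaling.TaggedPerAttemptCertificateEveryEdge
import Summits.Ventures.LatticeQCDFlow.Scaling.TaggedPerAttemptCertificateLoneBetweenAll

/-!
HONEST FRAMING: exact (Metropolis-corrected) sampling algorithms for lattice gauge theory; figures
of merit are autocorrelation/cost numbers at stated couplings and volumes; no continuum-physics
claim.

# TaggedPerAttemptCertificateEveryEdgeAll — CONJECTURE W′ ON EVERY ADJACENT EDGE FROM EVERY ORDINARY HUB, NO CONFIGURATION EXCLUDED, FOR EVERY `K ≥ 2`:
# `L·(x̃(★) + (x̃(a) − ỹ(a)) − D_J) ≥ cost(x̃) + cost(ỹ)` FOR EVERY TRUNCATION `J` (lean-2 GEN-43, ours)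

Venture-side (OURS).  Cell `lqcd-flow` (pub-lqcd), unit `pub-lqcd-lean-2-g43`, 2026-08-31.  Chapter AC (route (β), the cost side concluded), file 3 — the final assembly of the
σ-weighted per-attempt certificate of route (β) (MEMO-gen40 §4, the input C1–C4 consume): chapter AB file 13 (every edge, every hub but the lone hub strictly between, every `K ≥ 2`)
and file 2 of this chapter (the lone hub strictly between, every `K ≥ 2`).  Hypotheses: W14∕W26's tagged chains of an adjacent pair (`W_b ≤ W_a`, ANY present contents between the
extra particles) from an ordinary hub `z` (`N_C(z) ≠ 0`), `K ≥ 2`; NOTHING ELSE.  This supersedes chapter AB file 17 (`K ≥ 3`).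

* **`tagged_perAttempt_certificate_everyEdge_all`**: `cost(x̃) + cost(ỹ) ≤ L·(x̃(★) + (x̃(a) − ỹ(a)) − D_J)` for every `J`, `L = 2K + M_X + M_Y`,
  `D_J = Σ_{n<J}(1−σ)σⁿ(y_{n+1}(z) − x_{n+1}(z))⁺`.

What remains of OPEN-MATH (b′): `r_j` (C2) and C4 `clock_mixingTime_le'` for the lumped star from these per-edge certificates.  Literature grade (cell rule): OWN; nothing cited;
no new bib keys.
-/

open Finset

namespace Summit.Ventures.LatticeQCDFlow.Scaling

section EveryEdgeAll
variable {S : Type*} [Fintype S] [DecidableEq S]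
variable {W θ : S → ℝ} {acc : S → S → ℝ} {p : ℝ} {K : ℕ} {NC : S → ℕ} {a b : S} {PX PY : Option S → Option S → ℝ}

/-- **CONJECTURE W′ ON EVERY ADJACENT EDGE FROM EVERY ORDINARY HUB, EVERY `K ≥ 2`** (see the module docstring). [ours] -/
theorem tagged_perAttempt_certificate_everyEdge_all (hW : ∀ v, 0 < W v) (hp0 : 0 ≤ p) (hp : ∀ v, p * W v ≤ 1) (hθ : ∀ v, θ v = 1 / (1 + p * W v))
    (hacc : ∀ h v, acc h v = min 1 (W h / W v)) (hK : 2 ≤ K) (hNC : ∑ v, NC v = K) (hab : W b ≤ W a)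
    (hPXoff : ∀ h v, h ≠ v → PX (some h) (some v) = if NC h = 0 then 0 else (NC v : ℝ) / K * acc h v)
    (hPXin : ∀ h, PX (some h) none = if NC h = 0 then 0 else acc h a / K)
    (hPXdiag : ∀ h, PX (some h) (some h) = 1 - (∑ v ∈ univ.erase h, PX (some h) (some v) + PX (some h) none))
    (hPXout : ∀ v, PX none (some v) = (NC v : ℝ) / K * acc a v) (hPXstay : PX none none = 1 - ∑ v, PX none (some v))
    (hPYoff : ∀ h v, h ≠ v → PY (some h) (some v) = if NC h = 0 then 0 else (NC v : ℝ) / K * acc h v)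
    (hPYin : ∀ h, PY (some h) none = if NC h = 0 then 0 else acc h b / K)
    (hPYdiag : ∀ h, PY (some h) (some h) = 1 - (∑ v ∈ univ.erase h, PY (some h) (some v) + PY (some h) none))
    (hPYout : ∀ v, PY none (some v) = (NC v : ℝ) / K * acc b v) (hPYstay : PY none none = 1 - ∑ v, PY none (some v))
    {z : S} (hz : NC z ≠ 0)
    {x y : ℕ → Option S → ℝ}
    (hx0 : ∀ v, x 0 v = if v = some z then 1 else 0) (hxs : ∀ n v, x (n + 1) v = ∑ h, x n h * PX h v)
    (hy0 : ∀ v, y 0 v = if v = some z then 1 else 0) (hys : ∀ n v, y (n + 1) v = ∑ h, y n h * PY h v)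
    {M : ℝ} (hM : M = ∑ v, θ v * (NC v : ℝ) + θ a) {L : ℝ} (hL : L = 2 * K + M + (∑ v, θ v * (NC v : ℝ) + θ b))
    {σ : ℝ} (hσ0 : 0 ≤ σ) (hσ1 : σ < 1) {xt yt xs ys : Option S → ℝ}
    (hxt : ∀ t, xt t = (1 - σ) * PX (some z) t + σ * ∑ t', xt t' * PX t' t) (hyt : ∀ t, yt t = (1 - σ) * PY (some z) t + σ * ∑ t', yt t' * PY t' t)
    (hxsr : ∀ t, xs t = (1 - σ) * PX none t + σ * ∑ t', xs t' * PX t' t) (hysr : ∀ t, ys t = (1 - σ) * PY none t + σ * ∑ t', ys t' * PY t' t) (J : ℕ) :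
    (∑ v, xt (some v) * (1 - θ v) + xt none * (1 - θ a)) + (∑ v, yt (some v) * (1 - θ v) + yt none * (1 - θ b))
      ≤ L * (xt none + (xt (some a) - yt (some a)) - ∑ n ∈ range J, (1 - σ) * σ ^ n * max 0 (y (n + 1) (some z) - x (n + 1) (some z))) := by
  by_cases hlone : W b < W z ∧ W z < W a ∧ NC z = 1 ∧ ∀ w, w ≠ z → NC w ≠ 0 → W w < W z
  · obtain ⟨hbz, hza, hz1, hbelow⟩ := hlone
    exact tagged_perAttempt_certificate_loneBetween_all hW hp0 hp hθ hacc hK hNC hab hPXoff hPXin hPXdiag hPXout hPXstay hPYoff hPYin hPYdiag hPYout hPYstay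
      hz1 hbz.le hza hbelow hx0 hxs hy0 hys hM hL hσ0 hσ1 hxt hyt hxsr hysr J
  · exact tagged_perAttempt_certificate_everyEdge hW hp0 hp hθ hacc hK hNC hab hPXoff hPXin hPXdiag hPXout hPXstay hPYoff hPYin hPYdiag hPYout hPYstay
      hz hlone hx0 hxs hy0 hys hM hL hσ0 hσ1 hxt hyt hxsr hysr J

end EveryEdgeAll

end Summit.Ventures.LatticeQCDFlow.Scaling
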